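import Summits.NavierStokesRegularity.NavierStokesRegularity.Theorems.TaoForcedUniqueness.Negative.SerrinEnstrophySerrinClass

/-!
# KJ-6 (3/9): CONSTRUCTION of the co-moving junk family (`exists_junkFamily`)

Cell `ns-blowup`, seat `ns-blowup-refuter` (g10 blueprint, g11 kernel), KILLSHEET §XXIV rows KJ-6/KJ-7,
part 3/9 of the kernel certificate `¬ Literature.Analysis.FluidPDE.Sohr2001_serrinClass_enstrophyBound(_global)`
(final file `SohrSerrinEnstrophyCountableJunk.lean` in this directory, which carries the full account and the
classification). LABEL: refuter construction (explicit data + proved lemmas; no named facts, no `sorry`).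
WHAT THIS IS NOT: not Navier–Stokes evidence and not a statement about Sohr's printed theorem — a hygiene
refutation of two facts AS TYPED (slice-wise force class `MemLqLp 2 2`, one outer Bochner integral in the
weak form); nothing here mentions the summit.

Content (namespace `JunkBuild`, on refuter4's K54 part 2 `CountableJunkDirections.lean`: rational vector bumps
`bumpVec i`, `i = idxEnum m : ℚ³ × ℕ × Fin 3`, and the neighbourhood-basis totality lemma
`eq_zero_of_forall_integral_bump_mul`): `Φ c 0 := 0`, `Φ c (m+1) := s(c,i) • (bumpVec i − β(c,i) • U_c)` with
`β(c,i) := ∫⟪bumpVec i, U_c⟫ / ∫⟪U_c, U_c⟫` and `s(c,i) := (1 + ‖bumpVec i − β(c,i) U_c‖₂)⁻¹`; orthogonality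
(`integral_inner_Phi_dilate`), the bound `‖Φ c m‖₂ ≤ 1`, TOTALITY modulo `U_c` (`total_Phi`: the components of the
continuous field `ψ − α U_c` vanish), and joint measurability in the scale (`measurable_Phi`:
`StronglyMeasurable.integral_prod_right'`, `Measurable.lintegral_prod_right'`). Hence `junkFamily Pr : JunkFamily Pr`.
-/

noncomputable section

namespace Summit.NavierStokesRegularity.ForcedUniquenessHygiene.KJ6

open MeasureTheory Set Function Filter Topology Metric
open scoped ENNReal NNReal RealInnerProductSpace ContDiff Laplacian
open Literature.Analysis.FluidPDE Literature.Analysis.FunctionSpaces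

/-- Euclidean `ℝ³` (file-local notation, as in the `Literature.Analysis.FluidPDE` files). -/
local notation "ℝ³" => EuclideanSpace ℝ (Fin 3)

variable (Pr : Profile)

/-! ### The co-moving junk family (`exists_junkFamily`) -/
section JunkConstruction
open Summit.NavierStokesRegularity.ForcedUniquenessCountableJunk hiding frobeniusNormSq_smul

namespace JunkBuild

/-- Pointwise formula for the dilate. -/
theorem dilate_apply (c : ℝ) (x : ℝ³) : dilate c Pr.U x = Real.sqrt c • (c • Pr.U (c • x)) := rfl

/-- The dilate of the profile is continuous. -/
theorem continuous_dilate (c : ℝ) : Continuous (dilate c Pr.U) := by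
  have hU : Continuous Pr.U := Pr.smooth.continuous
  show Continuous fun x : ℝ³ => Real.sqrt c • (c • Pr.U (c • x))
  fun_prop

/-- Joint continuity of `(c, x) ↦ U_c x`. -/
theorem continuous_dilate₂ : Continuous fun p : ℝ × ℝ³ => dilate p.1 Pr.U p.2 := by
  have hU : Continuous Pr.U := Pr.smooth.continuous
  have h1 : Continuous fun p : ℝ × ℝ³ => Pr.U (p.1 • p.2) := hU.comp (continuous_fst.smul continuous_snd)
  have h2 : Continuous fun p : ℝ × ℝ³ => p.1 • Pr.U (p.1 • p.2) := continuous_fst.smul h1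
  have h3 : Continuous fun p : ℝ × ℝ³ => Real.sqrt p.1 • (p.1 • Pr.U (p.1 • p.2)) :=
    (Real.continuous_sqrt.comp continuous_fst).smul h2
  exact h3

/-- The dilate of the profile is in `L²` (also for the degenerate scales `c ≤ 0`). -/
theorem memLp_dilate (c : ℝ) : MemLp (dilate c Pr.U) 2 volume := by
  by_cases hc : c = 0
  · have h : dilate c Pr.U = 0 := by
      funext x; rw [dilate_apply, hc]; simp
    rw [h]; exact MemLp.zero
  · exact (memLp_nsRescaleData (Pr.memLp 2 le_rfl (by simp)) hc).const_smul _

/-- `‖U_c‖₂²` as a real number. -/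
def nU (c : ℝ) : ℝ := ∫ x, ⟪dilate c Pr.U x, dilate c Pr.U x⟫

/-- `‖U_c‖₂² > 0` for `c > 0`. -/
theorem nU_pos {c : ℝ} (hc : 0 < c) : 0 < nU Pr c := by
  have hU := memLp_dilate Pr c
  have hnn : 0 ≤ fun x => ⟪dilate c Pr.U x, dilate c Pr.U x⟫ := fun x => real_inner_self_nonneg
  unfold nU
  rw [integral_pos_iff_support_of_nonneg hnn (integrable_inner_of_memLp_two hU hU)]
  have hopen : IsOpen (Function.support fun x => ⟪dilate c Pr.U x, dilate c Pr.U x⟫) :=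
    ((continuous_dilate Pr c).inner (continuous_dilate Pr c)).isOpen_support
  obtain ⟨x₀, -, hx₀⟩ := Pr.far ∅ isCompact_empty
  refine hopen.measure_pos volume ⟨c⁻¹ • x₀, ?_⟩
  rw [Function.mem_support]
  have hx : c • c⁻¹ • x₀ = x₀ := by rw [smul_smul, mul_inv_cancel₀ hc.ne', one_smul]
  have hne : dilate c Pr.U (c⁻¹ • x₀) ≠ 0 := by
    rw [dilate_apply, hx]
    exact smul_ne_zero (Real.sqrt_pos.2 hc).ne' (smul_ne_zero hc.ne' hx₀)
  exact fun h => hne (inner_self_eq_zero.1 h)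

/-- The projection coefficient `β(c,i) = ⟪b_i, U_c⟫ / ‖U_c‖₂²`. -/
def beta (c : ℝ) (i : (ℚ × ℚ × ℚ) × ℕ × Fin 3) : ℝ :=
  (∫ x, ⟪bumpVec i x, dilate c Pr.U x⟫) / nU Pr c

/-- The bump with its `U_c`-component removed. -/
def projC (c : ℝ) (i : (ℚ × ℚ × ℚ) × ℕ × Fin 3) (x : ℝ³) : ℝ³ :=
  bumpVec i x - beta Pr c i • dilate c Pr.U x

/-- The projected bump `bumpVec i − β(c,i) • U_c` is continuous. -/
theorem continuous_projC (c : ℝ) (i : (ℚ × ℚ × ℚ) × ℕ × Fin 3) : Continuous (projC Pr c i) := by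
  show Continuous fun x => bumpVec i x - beta Pr c i • dilate c Pr.U x
  exact (continuous_bumpVec i).sub ((continuous_const (y := beta Pr c i)).smul (continuous_dilate Pr c))

/-- The projected bump is in `L²`. -/
theorem memLp_projC (c : ℝ) (i : (ℚ × ℚ × ℚ) × ℕ × Fin 3) : MemLp (projC Pr c i) 2 volume :=
  (memLp_bumpVec i).sub ((memLp_dilate Pr c).const_smul (beta Pr c i))

/-- `projC ⊥ U_c` for `c > 0`. -/
theorem integral_inner_projC_dilate {c : ℝ} (hc : 0 < c) (i : (ℚ × ℚ × ℚ) × ℕ × Fin 3) :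
    ∫ x, ⟪projC Pr c i x, dilate c Pr.U x⟫ = 0 := by
  have hU := memLp_dilate Pr c
  simp only [projC, inner_sub_left, real_inner_smul_left]
  rw [integral_sub (integrable_inner_of_memLp_two (memLp_bumpVec i) hU)
    ((integrable_inner_of_memLp_two hU hU).const_mul _), integral_const_mul]
  have hpos := nU_pos Pr hc
  simp only [beta, nU] at hpos ⊢
  field_simp
  ring

/-- The scale-dependent normalising factor `(1 + ‖projC‖₂)⁻¹ ∈ (0,1]`. -/
def sC (c : ℝ) (i : (ℚ × ℚ × ℚ) × ℕ × Fin 3) : ℝ := (1 + (eLpNorm (projC Pr c i) 2 volume).toReal)⁻¹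

/-- The normalising factor `s(c,i)` is positive. -/
theorem sC_pos (c : ℝ) (i : (ℚ × ℚ × ℚ) × ℕ × Fin 3) : 0 < sC Pr c i := by
  unfold sC; positivity

/-- **The co-moving junk family** `Φ c 0 = 0`, `Φ c (m+1) = s • projC`. -/
def Phi (c : ℝ) : ℕ → ℝ³ → ℝ³
  | 0 => 0
  | m + 1 => sC Pr c (idxEnum m) • projC Pr c (idxEnum m)

/-- Unfolding of `Φ c (m+1)`. -/
theorem Phi_succ (c : ℝ) (m : ℕ) : Phi Pr c (m + 1) = sC Pr c (idxEnum m) • projC Pr c (idxEnum m) := rfl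

/-- Every `Φ c m` is in `L²`. -/
theorem memLp_Phi (c : ℝ) : ∀ m, MemLp (Phi Pr c m) 2 volume
  | 0 => by
    show MemLp (0 : ℝ³ → ℝ³) 2 volume
    exact MemLp.zero
  | m + 1 => by
    rw [Phi_succ]; exact (memLp_projC Pr c _).const_smul _

/-- `‖Φ c m‖₂ ≤ 1`. -/
theorem eLpNorm_Phi_le_one (c : ℝ) : ∀ m, eLpNorm (Phi Pr c m) 2 volume ≤ 1
  | 0 => by simp [Phi]
  | m + 1 => by
    have hN : eLpNorm (projC Pr c (idxEnum m)) 2 volume ≠ ⊤ := (memLp_projC Pr c _).eLpNorm_ne_top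
    rw [Phi_succ, eLpNorm_const_smul, Real.enorm_eq_ofReal (sC_pos Pr _ _).le,
      ← ENNReal.ofReal_toReal hN, ← ENNReal.ofReal_mul (sC_pos Pr _ _).le,
      ENNReal.ofReal_le_one, sC]
    have hnn : 0 ≤ (eLpNorm (projC Pr c (idxEnum m)) 2 volume).toReal := ENNReal.toReal_nonneg
    rw [inv_mul_le_iff₀ (by positivity)]
    linarith

/-- ORTHOGONALITY: `∫⟪Φ c m, U_c⟫ = 0` for `c > 0`. -/
theorem integral_inner_Phi_dilate (c : ℝ) (hc : 0 < c) : ∀ m, ∫ x, ⟪Phi Pr c m x, dilate c Pr.U x⟫ = 0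
  | 0 => by simp [Phi]
  | m + 1 => by
    have h : ∀ x, Phi Pr c (m + 1) x = sC Pr c (idxEnum m) • projC Pr c (idxEnum m) x := fun x => rfl
    simp only [h, real_inner_smul_left, integral_const_mul, integral_inner_projC_dilate Pr hc, mul_zero]

/-- **Totality modulo `U_c`.** -/
theorem total_Phi {c : ℝ} (hc : 0 < c) {ψ : ℝ³ → ℝ³} (hψ : Continuous ψ) (hψc : HasCompactSupport ψ)
    (h : ∀ m, 1 ≤ m → ∫ x, ⟪Phi Pr c m x, ψ x⟫ = 0) : ∃ a : ℝ, ψ = a • dilate c Pr.U := by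
  have hU := memLp_dilate Pr c
  have hψ2 : MemLp ψ 2 volume := hψ.memLp_of_hasCompactSupport hψc
  set α : ℝ := (∫ x, ⟪dilate c Pr.U x, ψ x⟫) / nU Pr c with hα
  -- Step 1: every bump is orthogonal to `ψ - α U_c`
  have h1 : ∀ i : (ℚ × ℚ × ℚ) × ℕ × Fin 3, ∫ x, ⟪bumpVec i x, ψ x - α • dilate c Pr.U x⟫ = 0 := by
    intro i
    obtain ⟨n, hn⟩ := idxEnum_surjective i
    have e1 := h (n + 1) (Nat.succ_le_succ (Nat.zero_le _))
    have hj : ∀ x, Phi Pr c (n + 1) x =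
        sC Pr c i • (bumpVec i x - beta Pr c i • dilate c Pr.U x) := fun x => by
      simp only [Phi, hn]; rfl
    simp only [hj, real_inner_smul_left, integral_const_mul, inner_sub_left] at e1
    have e2 := (mul_eq_zero.1 e1).resolve_left (sC_pos Pr c i).ne'
    rw [integral_sub (integrable_inner_of_memLp_two (memLp_bumpVec i) hψ2)
      ((integrable_inner_of_memLp_two hU hψ2).const_mul _), integral_const_mul, sub_eq_zero] at e2
    simp only [inner_sub_right, real_inner_smul_right]
    rw [integral_sub (integrable_inner_of_memLp_two (memLp_bumpVec i) hψ2)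
      ((integrable_inner_of_memLp_two (memLp_bumpVec i) hU).const_mul _), integral_const_mul, e2,
      hα, beta]
    have hpos := nU_pos Pr hc
    rw [nU] at hpos ⊢
    field_simp
    ring
  -- Step 2: components of `ψ - α U_c` vanish
  have h2 : ∀ (j : Fin 3) (x : ℝ³), (ψ x - α • dilate c Pr.U x) j = 0 := by
    intro j
    refine eq_zero_of_forall_integral_bump_mul
      ((EuclideanSpace.proj j).continuous.comp (hψ.sub ((continuous_const (y := α)).smul (continuous_dilate Pr c)))) ?_
    intro q n
    have := h1 (q, n, j)
    simpa [bumpVec, real_inner_smul_left, e, EuclideanSpace.inner_single_left] using this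
  -- Step 3: `ψ = α U_c`
  refine ⟨α, funext fun x => ?_⟩
  have h3 : ψ x = α • dilate c Pr.U x := sub_eq_zero.1 (PiLp.ext fun j => by simpa using h2 j x)
  rw [h3, Pi.smul_apply]

/-! ### Measurability in the scale -/

/-- `c ↦ ‖U_c‖₂²` is measurable. -/
theorem measurable_nU : Measurable (nU Pr) := by
  have hG : Continuous fun p : ℝ × ℝ³ => ⟪dilate p.1 Pr.U p.2, dilate p.1 Pr.U p.2⟫ :=
    (continuous_dilate₂ Pr).inner (continuous_dilate₂ Pr)
  exact (hG.stronglyMeasurable.integral_prod_right' (ν := volume)).measurable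

/-- `c ↦ β(c,i)` is measurable. -/
theorem measurable_beta (i : (ℚ × ℚ × ℚ) × ℕ × Fin 3) : Measurable fun c => beta Pr c i := by
  have hG : Continuous fun p : ℝ × ℝ³ => ⟪bumpVec i p.2, dilate p.1 Pr.U p.2⟫ :=
    ((continuous_bumpVec i).comp continuous_snd).inner (continuous_dilate₂ Pr)
  exact (hG.stronglyMeasurable.integral_prod_right' (ν := volume)).measurable.div (measurable_nU Pr)

/-- The projected bump is jointly measurable in `(c, x)`. -/
theorem measurable_projC₂ (i : (ℚ × ℚ × ℚ) × ℕ × Fin 3) :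
    Measurable fun p : ℝ × ℝ³ => projC Pr p.1 i p.2 := by
  have h1 : Measurable fun p : ℝ × ℝ³ => bumpVec i p.2 :=
    (continuous_bumpVec i).measurable.comp measurable_snd
  have h2 : Measurable fun p : ℝ × ℝ³ => beta Pr p.1 i • dilate p.1 Pr.U p.2 :=
    ((measurable_beta Pr i).comp measurable_fst).smul (continuous_dilate₂ Pr).measurable
  exact h1.sub h2

/-- `c ↦ s(c,i)` is measurable. -/
theorem measurable_sC (i : (ℚ × ℚ × ℚ) × ℕ × Fin 3) : Measurable fun c => sC Pr c i := by
  have hF : Measurable fun p : ℝ × ℝ³ => ‖projC Pr p.1 i p.2‖ₑ ^ (2 : ℝ) :=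
    (measurable_projC₂ Pr i).enorm.pow_const _
  have hL : Measurable fun c => ∫⁻ x, ‖projC Pr c i x‖ₑ ^ (2 : ℝ) := hF.lintegral_prod_right'
  have hE : (fun c => eLpNorm (projC Pr c i) 2 volume) =
      fun c => (∫⁻ x, ‖projC Pr c i x‖ₑ ^ (2 : ℝ)) ^ (1 / (2 : ℝ)) := by
    funext c
    rw [eLpNorm_eq_lintegral_rpow_enorm_toReal (by norm_num) (by norm_num), ENNReal.toReal_ofNat]
  have hE' : Measurable fun c => eLpNorm (projC Pr c i) 2 volume := by
    rw [hE]; exact hL.pow_const _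
  unfold sC
  exact (measurable_const.add hE'.ennreal_toReal).inv

/-- JOINT MEASURABILITY: `(c, x) ↦ Φ c m x` is measurable for every `m`. -/
theorem measurable_Phi : ∀ m, Measurable (uncurry fun c x => Phi Pr c m x)
  | 0 => by
    show Measurable fun p : ℝ × ℝ³ => (0 : ℝ³ → ℝ³) p.2
    exact measurable_const
  | m + 1 => by
    show Measurable fun p : ℝ × ℝ³ => (sC Pr p.1 (idxEnum m) • projC Pr p.1 (idxEnum m)) p.2
    exact ((measurable_sC Pr (idxEnum m)).comp measurable_fst).smul (measurable_projC₂ Pr (idxEnum m))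

end JunkBuild

/-- **The co-moving junk family exists** (refuter4's rational bumps, projected off `U_c`, normalised). -/
def junkFamily : JunkFamily Pr where
  Φ := JunkBuild.Phi Pr
  zero := fun _ => rfl
  memLp := JunkBuild.memLp_Phi Pr
  norm_le := JunkBuild.eLpNorm_Phi_le_one Pr
  orth := fun c m hc => JunkBuild.integral_inner_Phi_dilate Pr c hc m
  total := fun _ hc _ hψ hψc h => JunkBuild.total_Phi Pr hc hψ hψc h
  measurable := JunkBuild.measurable_Phi Pr

/-- A junk family attached to the profile exists (`junkFamily`). -/
theorem exists_junkFamily : Nonempty (JunkFamily Pr) := ⟨junkFamily Pr⟩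

end JunkConstruction

end Summit.NavierStokesRegularity.ForcedUniquenessHygiene.KJ6
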